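import Summits.QuantumFields.YangMills.Theorems.LuscherReductionTwistedTraceScalingBOStiffDefs
import Summits.QuantumFields.YangMills.Theorems.LuscherReductionTwistedTraceScalingFPWeightRelative
import HarnessLib

/-!
# (B-ST) central-fibre FLAT MODEL objects (route-posited abbreviations for the door data `D, J₀` of `spec_gap_inputs`)
# (lane A of S-BASE, crux `TwistedTraceScaling` stmt-QuantumFields-20203, C4-CORE, the (B-ST) pen; `pub/ym-fleet/ym-luscher-20007-p1/HANDOFF-g22.md` §DESIGN 2–4)

The two-sided pointwise asymptotics of the central based kernel on the profile support (✓`…BOStiffCentralLower.cM_lower`, ✓`…BOStiffCentralUpper.cM_upper`):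
`cM β x x' = (1 ± ε)·cA β·cK β x x'` up to an `e^{−ℓ⁴/(144L²)}`-tail, with the MODEL JUMP `cK` (true magnetic factors × the gauge-flat stiff Gaussian jump) and the
AMPLITUDE `cA = (e^{2β})^{|E|}·fpWeightBar(β^{-1/2})`.  This file only NAMES the objects the remaining (B-ST) statements repeat (no claims):
`cK`, `cA`, the flat model DENSITY `cD` of ✓`…BOStiffCentralDensity` (`cΘ²cW = (1±ε)cD` on `cS`), the profile-weighted jump mass `cIk = ∫∫ cΘ·cK·cΘ dπ²`, the profile mass
`cZ = ∫ cΘ²cW dπ` (the denominator of `cΛ`), and the `π`-NORMALISED MODEL JUMP KERNEL `cJ0 = cΘ(x)·cK(x,x')·cΘ(x')·cZ/cIk` — the `J₀` of `spec_gap_inputs` (it vanishes off `cS × cS`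
because `cΘ` does; its total `π²`-mass is `cZ`).  With these, the jump floor `hJ` holds with the β-free `cJ = 1/6` (next file `…BOStiffJumpFloor`), and `hflat` is the Poincaré
inequality of the `D`-reversible model chain `J₀` (Mehler ⊗ resampling, hand w3).
HONEST FRAMING: definitions for a stub of a child of the CONDITIONAL route R2b1; (B-ST) OPEN; C4-CORE OPEN; not infinite volume, not a gap, not Clay.
-/

set_option autoImplicit false

noncomputable section

open MeasureTheory
open Literature.MathematicalPhysics.QuantumFieldTheory Literature.MathematicalPhysics.QuantumLattice

namespace Summit.QuantumFields.YangMills.Theorems.FemtoTransferGap.TwoLattice.ConstTube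

open TwoLattice.Avg TwoLattice.Stiff TwoLattice.GnChart TwoLattice.Cov

variable (L : ℕ) [NeZero L]

/-- The **model jump** of the fibre block: `cK β x x' = e^{−(β/2)(S(orthoTube 1 x) + S(orthoTube 1 x'))}·e^{−β‖(x̂−x̂') − P_Γ(x̂−x̂')‖²}` — the true magnetic factors times the
stiff Gaussian jump, FLAT in the gauge directions (`x̂ = linkEmbed x`, `P_Γ = (gaugeModes L).starProjection`). [cite: Luscher1983, §3] -/
def cK (β : ℝ) (x x' : Edge 3 L → Fin 3 → ℝ) : ℝ :=
  Real.exp (-(β / 2 * (wilsonAction su2Rep (orthoTube L 1 x) + wilsonAction su2Rep (orthoTube L 1 x')))) *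
    Real.exp (-(β * ‖(linkEmbed L (x - x')) - (gaugeModes L).starProjection (linkEmbed L (x - x'))‖ ^ 2))

/-- The **amplitude** `cA β = (e^{2β})^{|E|}·fpWeightBar L (powScale (1/2) β)` of the two-sided asymptotics `cM = (1±ε)·cA·cK`. [cite: Luscher1983, §3] -/
def cA (β : ℝ) : ℝ := Real.exp (2 * β) ^ Fintype.card (Edge 3 L) * fpWeightBar L (powScale (1 / 2) β)

/-- The **flat model density** `cD β x = N̄(β⁻¹)·e^{−‖P_Γ x̂‖²/β^{-2}}·e^{−2 q_β(x̂)}` (`N̄ = fpWeightBar L (powScale 1 β)`, `q_β = stiffGaussExp L (β/2) β`); on `cS`,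
`cΘ²·cW = (1 ± ε)·cD` (✓`central_density_compare`). [cite: Luscher1983, §3] -/
def cD (β : ℝ) (x : Edge 3 L → Fin 3 → ℝ) : ℝ :=
  fpWeightBar L (powScale 1 β) * (Real.exp (-(‖(gaugeModes L).starProjection (linkEmbed L x)‖ ^ 2 / powScale 1 β ^ 2)) *
    Real.exp (-(2 * stiffGaussExp L (β / 2) β (linkEmbed L x))))

/-- The **profile-weighted model jump mass** `cIk β = ∫∫ cΘ(x)·cK(x,x')·cΘ(x') dπ dπ`. [folklore] -/
def cIk (β : ℝ) : ℝ := ∫ x, ∫ y, cΘ L β x * cK L β x y * cΘ L β y ∂orthoTransverse L ∂orthoTransverse L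

/-- The **profile mass** `cZ s M β = ∫ cΘ²·cW dπ` (the denominator of `cΛ`). [folklore] -/
def cZ (s M β : ℝ) : ℝ := ∫ x, cΘ L β x ^ 2 * cW L s M β x ∂orthoTransverse L

/-- The **π-normalised model jump kernel** `cJ0 s M β x x' = cΘ(x)·cK(x,x')·cΘ(x')·cZ/cIk` — the `J₀` of `spec_gap_inputs` (zero off `cS × cS`, total `π²`-mass `cZ`). [cite: Luscher1983, §3] -/
def cJ0 (s M β : ℝ) (x x' : Edge 3 L → Fin 3 → ℝ) : ℝ := cΘ L β x * cK L β x x' * cΘ L β x' * (cZ L s M β / cIk L β)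

end Summit.QuantumFields.YangMills.Theorems.FemtoTransferGap.TwoLattice.ConstTube

end
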